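import Mathlib
import Literature.AlgebraicGeometry.Resolution.PolygonInvariantsIndexed
import Literature.AlgebraicGeometry.Resolution.Isolation
import HarnessLib

/-!
# Isolation and the polygon in ARBITRARY embedding dimension: `α < 1`, `ε < 1`, and Newton points exist (CJS Lemma 11.5)

Topic: `Literature/AlgebraicGeometry/Resolution`. Dimension-general form of `Isolation.lean` (`c : Fin 3 → R`): ninth brick of the
generalisation `Fin 3 → Fin (r+2)` of the tree's expansion-free rendering of Hironaka's characteristic polyhedra (memo
`run/shared/lean/pub/res-hironaka/L/res-L1-w42-stub-3/KEYCLAIM-PORT-PLAN.md` §4–§5). Cossart–Jannsen–Saito, LNM 2270, **Lemma 11.5**: no regular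
curve `D ⊆ X_max` through `x` gives `α(f, y, u) < 1` and `ε(f, y, u) < 1` («Assume `α ≥ 1`. Then, letting `𝔭 = ⟨y₁, …, y_r, u₁⟩`, we have
`v_𝔭(f_j) ≥ n_j` … `H_X(η) = H_X(x)` … `Spec(R/𝔭)` is permissible, which contradicts the assumption»; Cossart–Piltant 2008, (16)). The ring side,
for an ideal `J ⊆ 𝔪^μ` of a regular local ring with r.s.p. `c = (y₁, …, y_r, u₁, u₂) : Fin (r + 2) → R`: `V(y, u₁) ⊆ Σ_μ` means
`J ⊆ (y₁, …, y_r, u₁)^μ`. PROVED (ns `WeightedOrder`; the `Fin 3` statements and proofs verbatim with the y-block in place of `y`):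

* `alphaS_lt_of_not_le_yu1_pow` — **`J ⊄ (y, u₁)^μ ⇒ αs < L`** (and Newton points exist);
* `epsS_lt_of_not_le_yu2_pow` — **`J ⊄ (y, u₂)^μ ⇒ εs < L`**;
* `pts_nonempty_of_not_le_y_pow` — **`J ⊄ (y)^μ ⇒` Newton points exist;**
* `yu1Ideal_pow_le_weightedOrderIdeal` (`(y, u₁)^μ ⊆ F^{(K,…,K,K,1)}_{Kμ}`) and `exists_unitRep_pPow` (unit representatives of elements of
  `(y, u₁)^μ` supported in `{|e|_y + e_{u₁} ≥ μ}` — the input of the curve chart, CJS Lemma 12.4 (1)).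

Method (as in the `Fin 3` file): Krull (`exists_not_mem_sup_pow`) yields `K` with `f ∉ I + 𝔪^K`; the weighted ideal of the weight `(K, …, K, K, 1)`
(resp. `(K, …, K, 1, K)`, `(K, …, K, 1, 1)`) at level `K μ` lies inside `I + 𝔪^K`, so `f` has an initial unit term of small weight, i.e. a Newton
point with `x₁ < L` (resp. `x₂ < L`, resp. of y-degree `< μ`).

Sources: V. Cossart, U. Jannsen, S. Saito, LNM **2270** (2020), Lemma 11.5, Def. 8.4 [`CossartJannsenSaito2020`]; V. Cossart, O. Piltant, J. Algebra
320 (2008), §4, (16) [`CossartPiltant2008`]. No named facts; no instance, notation or attribute.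
-/

noncomputable section

open IsLocalRing MvPolynomial

namespace Literature.AlgebraicGeometry.Resolution

namespace WeightedOrder

universe u

section Isolation

variable {R : Type u} [CommRing R] {r : ℕ} (c : Fin (r + 2) → R)

/-- The y-block `(y₁, …, y_r)` of `c = (y, u₁, u₂)`. [cite: CossartJannsenSaito2020, Def. 7.2 (1)] -/
def yPart (c : Fin (r + 2) → R) : Fin r → R := fun i => c (Fin.castAdd 2 i)

/-- The ideal `(y₁, …, y_r)`. [cite: CossartJannsenSaito2020, Lemma 11.5] -/
def yIdeal (c : Fin (r + 2) → R) : Ideal R := Ideal.span (Set.range (yPart c))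

/-- The ideal `𝔭 = (y₁, …, y_r, u₁)` of the `u₂`-axis `V(y, u₁)` (CJS Lemma 11.5's `𝔭`). [cite: CossartJannsenSaito2020, Lemma 11.5] -/
def yu1Ideal (c : Fin (r + 2) → R) : Ideal R := Ideal.span (insert (c (u1 r)) (Set.range (yPart c)))

/-- The ideal `(y₁, …, y_r, u₂)` of the `u₁`-axis `V(y, u₂)`. [cite: CossartJannsenSaito2020, Lemma 11.5] -/
def yu2Ideal (c : Fin (r + 2) → R) : Ideal R := Ideal.span (insert (c (u2 r)) (Set.range (yPart c)))

/-- The y-part of a monomial lies in `(y)^{|e|_y}`. [cite: CossartJannsenSaito2020, Def. 7.2 (1)] -/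
theorem prod_yPart_pow_mem (e : Fin (r + 2) →₀ ℕ) {I : Ideal R} (hI : ∀ i : Fin r, c (Fin.castAdd 2 i) ∈ I) :
    ∏ i : Fin r, c (Fin.castAdd 2 i) ^ e (Fin.castAdd 2 i) ∈ I ^ ydeg e := by
  rw [ydeg, ← Finset.prod_pow_eq_pow_sum]
  exact Ideal.prod_mem_prod fun i _ => Ideal.pow_mem_pow (hI i) _

/-- `c^e = (∏ y_i^{e_{y_i}}) · u₁^{e_{u₁}} · u₂^{e_{u₂}}`. [cite: CossartJannsenSaito2020, (7.3)] -/
theorem cmonom_eq_yPart_mul (e : Fin (r + 2) →₀ ℕ) :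
    cmonom c e = (∏ i : Fin r, c (Fin.castAdd 2 i) ^ e (Fin.castAdd 2 i)) * c (u1 r) ^ e (u1 r) * c (u2 r) ^ e (u2 r) := by
  rw [cmonom_eq_prod, Fin.prod_univ_add, Fin.prod_univ_two, u1, u2]
  ring

/-- The weight `(K, …, K, K, 1)` (`u₂` of weight `1`, everything else of weight `K`). [cite: CossartJannsenSaito2020, Lemma 11.5] -/
def wK1 (r K : ℕ) : Fin (r + 2) → ℕ := fun i => if i = u2 r then 1 else K

/-- The weight `(K, …, K, 1, K)` (`u₁` of weight `1`). [cite: CossartJannsenSaito2020, Lemma 11.5] -/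
def wK2 (r K : ℕ) : Fin (r + 2) → ℕ := fun i => if i = u1 r then 1 else K

/-- The weight `(K, …, K, 1, 1)` (`u₁, u₂` of weight `1`, the y-block of weight `K`). [cite: CossartJannsenSaito2020, Def. 8.4] -/
def wKy (r K : ℕ) : Fin (r + 2) → ℕ := fun i => if i = u1 r ∨ i = u2 r then 1 else K

/-- `castAdd` indices are neither `u₁` nor `u₂`. [cite: CossartJannsenSaito2020, Def. 7.2 (1)] -/
theorem castAdd_ne_u1 (i : Fin r) : (Fin.castAdd 2 i : Fin (r + 2)) ≠ u1 r := by
  intro h; have := congrArg Fin.val h; have hi := i.isLt; simp [u1, Fin.castAdd, Fin.natAdd] at this; omega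

/-- `castAdd` indices are neither `u₁` nor `u₂`. [cite: CossartJannsenSaito2020, Def. 7.2 (1)] -/
theorem castAdd_ne_u2 (i : Fin r) : (Fin.castAdd 2 i : Fin (r + 2)) ≠ u2 r := by
  intro h; have := congrArg Fin.val h; have hi := i.isLt; simp [u2, Fin.castAdd, Fin.natAdd] at this; omega

/-- `⟨(K,…,K,K,1), e⟩ = K (|e|_y + e_{u₁}) + e_{u₂}`. [cite: CossartJannsenSaito2020, Lemma 11.5] -/
theorem weight_wK1 (K : ℕ) (e : Fin (r + 2) →₀ ℕ) : Finsupp.weight (wK1 r K) e = K * (ydeg e + e (u1 r)) + e (u2 r) := by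
  rw [Finsupp.weight_apply, Finsupp.sum_fintype _ _ (by simp), Fin.sum_univ_add, Fin.sum_univ_two, ydeg, Nat.mul_add, Finset.mul_sum]
  have hy : ∀ i : Fin r, wK1 r K (Fin.castAdd 2 i) = K := fun i => by simp [wK1, castAdd_ne_u2]
  have h1 : wK1 r K (Fin.natAdd r 0) = K := by simp [wK1, u2, Fin.natAdd]
  have h2 : wK1 r K (Fin.natAdd r 1) = 1 := by simp [wK1, u2]
  simp only [smul_eq_mul, hy, h1, h2, u1, u2, mul_one]
  rw [Finset.sum_congr rfl fun i _ => mul_comm (e (Fin.castAdd 2 i)) K]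
  ring

/-- `⟨(K,…,K,1,K), e⟩ = K (|e|_y + e_{u₂}) + e_{u₁}`. [cite: CossartJannsenSaito2020, Lemma 11.5] -/
theorem weight_wK2 (K : ℕ) (e : Fin (r + 2) →₀ ℕ) : Finsupp.weight (wK2 r K) e = K * (ydeg e + e (u2 r)) + e (u1 r) := by
  rw [Finsupp.weight_apply, Finsupp.sum_fintype _ _ (by simp), Fin.sum_univ_add, Fin.sum_univ_two, ydeg, Nat.mul_add, Finset.mul_sum]
  have hy : ∀ i : Fin r, wK2 r K (Fin.castAdd 2 i) = K := fun i => by simp [wK2, castAdd_ne_u1]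
  have h1 : wK2 r K (Fin.natAdd r 0) = 1 := by simp [wK2, u1]
  have h2 : wK2 r K (Fin.natAdd r 1) = K := by simp [wK2, u1, Fin.natAdd]
  simp only [smul_eq_mul, hy, h1, h2, u1, u2, mul_one]
  rw [Finset.sum_congr rfl fun i _ => mul_comm (e (Fin.castAdd 2 i)) K]
  ring

/-- `⟨(K,…,K,1,1), e⟩ = K |e|_y + e_{u₁} + e_{u₂}`. [cite: CossartJannsenSaito2020, Def. 8.4] -/
theorem weight_wKy (K : ℕ) (e : Fin (r + 2) →₀ ℕ) : Finsupp.weight (wKy r K) e = K * ydeg e + e (u1 r) + e (u2 r) := by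
  rw [Finsupp.weight_apply, Finsupp.sum_fintype _ _ (by simp), Fin.sum_univ_add, Fin.sum_univ_two, ydeg, Finset.mul_sum]
  have hy : ∀ i : Fin r, wKy r K (Fin.castAdd 2 i) = K := fun i => by simp [wKy, castAdd_ne_u1, castAdd_ne_u2]
  have h1 : wKy r K (Fin.natAdd r 0) = 1 := by simp [wKy, u1]
  have h2 : wKy r K (Fin.natAdd r 1) = 1 := by simp [wKy, u2]
  simp only [smul_eq_mul, hy, h1, h2, u1, u2, mul_one]
  rw [Finset.sum_congr rfl fun i _ => mul_comm (e (Fin.castAdd 2 i)) K, add_assoc]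

/-- All entries of the three weights are positive when `K > 0`. [cite: CossartJannsenSaito2020, Lemma 11.5] -/
theorem wK1_pos {K : ℕ} (hK : 0 < K) : ∀ i, 0 < wK1 r K i := fun i => by
  unfold wK1; split_ifs <;> omega

/-- All entries of the three weights are positive when `K > 0`. [cite: CossartJannsenSaito2020, Lemma 11.5] -/
theorem wK2_pos {K : ℕ} (hK : 0 < K) : ∀ i, 0 < wK2 r K i := fun i => by
  unfold wK2; split_ifs <;> omega

/-- All entries of the three weights are positive when `K > 0`. [cite: CossartJannsenSaito2020, Def. 8.4] -/
theorem wKy_pos {K : ℕ} (hK : 0 < K) : ∀ i, 0 < wKy r K i := fun i => by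
  unfold wKy; split_ifs <;> omega

variable [IsLocalRing R] (hgen : Ideal.span (Set.range c) = maximalIdeal R)

include hgen in
/-- Every parameter lies in `𝔪`. [cite: CossartJannsenSaito2020, Def. 7.2 (1)] -/
theorem apply_mem_maximalIdeal (i : Fin (r + 2)) : c i ∈ maximalIdeal R := hgen ▸ Ideal.subset_span ⟨i, rfl⟩

include hgen in
/-- `F^{(K,…,K,K,1)}_{Kμ} ⊆ (y, u₁)^μ + 𝔪^K`. [cite: CossartJannsenSaito2020, Lemma 11.5] -/
theorem weightedOrderIdeal_wK1_le (K μ : ℕ) : weightedOrderIdeal c (wK1 r K) (K * μ) ≤ yu1Ideal c ^ μ ⊔ maximalIdeal R ^ K := by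
  rw [weightedOrderIdeal, Ideal.span_le]
  rintro _ ⟨e, he, rfl⟩
  replace he : K * μ ≤ _ := he
  rw [weight_wK1] at he
  rw [cmonom_eq_yPart_mul, SetLike.mem_coe]
  by_cases h : μ ≤ ydeg e + e (u1 r)
  · refine Ideal.mem_sup_left (Ideal.mul_mem_right _ _ ?_)
    have hy : ∏ i : Fin r, c (Fin.castAdd 2 i) ^ e (Fin.castAdd 2 i) ∈ yu1Ideal c ^ ydeg e :=
      prod_yPart_pow_mem c e fun i => Ideal.subset_span (Set.mem_insert_of_mem _ ⟨i, rfl⟩)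
    have h1 : c (u1 r) ^ e (u1 r) ∈ yu1Ideal c ^ e (u1 r) := Ideal.pow_mem_pow (Ideal.subset_span (Set.mem_insert _ _)) _
    have := Ideal.mul_mem_mul hy h1
    rw [← pow_add] at this
    exact Ideal.pow_le_pow_right h this
  · push Not at h
    refine Ideal.mem_sup_right (Ideal.mul_mem_left _ _ ?_)
    have hK : K ≤ e (u2 r) := by
      have : K * (ydeg e + e (u1 r)) + K ≤ K * μ := by rw [← Nat.mul_succ]; exact Nat.mul_le_mul_left _ h
      omega
    exact Ideal.pow_le_pow_right hK (Ideal.pow_mem_pow (apply_mem_maximalIdeal c hgen _) _)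

include hgen in
/-- `F^{(K,…,K,1,K)}_{Kμ} ⊆ (y, u₂)^μ + 𝔪^K`. [cite: CossartJannsenSaito2020, Lemma 11.5] -/
theorem weightedOrderIdeal_wK2_le (K μ : ℕ) : weightedOrderIdeal c (wK2 r K) (K * μ) ≤ yu2Ideal c ^ μ ⊔ maximalIdeal R ^ K := by
  rw [weightedOrderIdeal, Ideal.span_le]
  rintro _ ⟨e, he, rfl⟩
  replace he : K * μ ≤ _ := he
  rw [weight_wK2] at he
  rw [cmonom_eq_yPart_mul, SetLike.mem_coe]
  by_cases h : μ ≤ ydeg e + e (u2 r)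
  · refine Ideal.mem_sup_left ?_
    have hy : ∏ i : Fin r, c (Fin.castAdd 2 i) ^ e (Fin.castAdd 2 i) ∈ yu2Ideal c ^ ydeg e :=
      prod_yPart_pow_mem c e fun i => Ideal.subset_span (Set.mem_insert_of_mem _ ⟨i, rfl⟩)
    have h2 : c (u2 r) ^ e (u2 r) ∈ yu2Ideal c ^ e (u2 r) := Ideal.pow_mem_pow (Ideal.subset_span (Set.mem_insert _ _)) _
    have hmem := Ideal.mul_mem_mul hy h2
    rw [← pow_add] at hmem
    have hmem' := Ideal.pow_le_pow_right h hmem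
    have : (∏ i : Fin r, c (Fin.castAdd 2 i) ^ e (Fin.castAdd 2 i)) * c (u1 r) ^ e (u1 r) * c (u2 r) ^ e (u2 r) =
        c (u1 r) ^ e (u1 r) * ((∏ i : Fin r, c (Fin.castAdd 2 i) ^ e (Fin.castAdd 2 i)) * c (u2 r) ^ e (u2 r)) := by ring
    rw [this]; exact Ideal.mul_mem_left _ _ hmem'
  · push Not at h
    have hK : K ≤ e (u1 r) := by
      have : K * (ydeg e + e (u2 r)) + K ≤ K * μ := by rw [← Nat.mul_succ]; exact Nat.mul_le_mul_left _ h
      omega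
    refine Ideal.mem_sup_right ?_
    have hmem := Ideal.pow_le_pow_right hK (Ideal.pow_mem_pow (apply_mem_maximalIdeal c hgen (u1 r)) (e (u1 r)))
    have : (∏ i : Fin r, c (Fin.castAdd 2 i) ^ e (Fin.castAdd 2 i)) * c (u1 r) ^ e (u1 r) * c (u2 r) ^ e (u2 r) =
        ((∏ i : Fin r, c (Fin.castAdd 2 i) ^ e (Fin.castAdd 2 i)) * c (u2 r) ^ e (u2 r)) * c (u1 r) ^ e (u1 r) := by ring
    rw [this]; exact Ideal.mul_mem_left _ _ hmem

include hgen in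
/-- `F^{(K,…,K,1,1)}_{Kμ} ⊆ (y)^μ + 𝔪^K`. [cite: CossartJannsenSaito2020, Def. 8.4] -/
theorem weightedOrderIdeal_wKy_le (K μ : ℕ) : weightedOrderIdeal c (wKy r K) (K * μ) ≤ yIdeal c ^ μ ⊔ maximalIdeal R ^ K := by
  rw [weightedOrderIdeal, Ideal.span_le]
  rintro _ ⟨e, he, rfl⟩
  replace he : K * μ ≤ _ := he
  rw [weight_wKy] at he
  rw [cmonom_eq_yPart_mul, SetLike.mem_coe]
  by_cases h : μ ≤ ydeg e
  · refine Ideal.mem_sup_left (Ideal.mul_mem_right _ _ (Ideal.mul_mem_right _ _ ?_))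
    exact Ideal.pow_le_pow_right h (prod_yPart_pow_mem c e fun i => Ideal.subset_span ⟨i, rfl⟩)
  · push Not at h
    have hK : K ≤ e (u1 r) + e (u2 r) := by
      have : K * ydeg e + K ≤ K * μ := by rw [← Nat.mul_succ]; exact Nat.mul_le_mul_left _ h
      omega
    refine Ideal.mem_sup_right ?_
    have hmem : c (u1 r) ^ e (u1 r) * c (u2 r) ^ e (u2 r) ∈ maximalIdeal R ^ (e (u1 r) + e (u2 r)) := by
      rw [pow_add]
      exact Ideal.mul_mem_mul (Ideal.pow_mem_pow (apply_mem_maximalIdeal c hgen _) _)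
        (Ideal.pow_mem_pow (apply_mem_maximalIdeal c hgen _) _)
    have : (∏ i : Fin r, c (Fin.castAdd 2 i) ^ e (Fin.castAdd 2 i)) * c (u1 r) ^ e (u1 r) * c (u2 r) ^ e (u2 r) =
        (∏ i : Fin r, c (Fin.castAdd 2 i) ^ e (Fin.castAdd 2 i)) * (c (u1 r) ^ e (u1 r) * c (u2 r) ^ e (u2 r)) := by ring
    rw [this]; exact Ideal.mul_mem_left _ _ (Ideal.pow_le_pow_right hK hmem)

end Isolation

section IsolationRegular

variable {R : Type u} [CommRing R] [IsRegularLocalRing R] {r : ℕ} (c : Fin (r + 2) → R)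
  (hgen : Ideal.span (Set.range c) = maximalIdeal R) (hdim : ringKrullDim R = r + 2) {J : Ideal R} {μ : ℕ}

include hgen hdim in
/-- **`J ⊄ (y, u₁)^μ ⇒ α < 1`** (scaled: `αs < L`), and Newton points exist — CJS Lemma 11.5's `α`-half, expansion-free.
[cite: CossartJannsenSaito2020, Lemma 11.5] [cite: CossartPiltant2008, (16)] -/
theorem alphaS_lt_of_not_le_yu1_pow (hJ : ¬ J ≤ yu1Ideal c ^ μ) : (pts c J μ).Nonempty ∧ alphaS c J μ < μ.factorial := by
  classical
  obtain ⟨f, hfJ, hf⟩ := Set.not_subset.mp hJ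
  obtain ⟨K₀, hK₀⟩ := exists_not_mem_sup_pow hf
  set K := K₀ + 1 with hK
  have hfK : f ∉ yu1Ideal c ^ μ ⊔ maximalIdeal R ^ K := fun h =>
    hK₀ (sup_le_sup_left (Ideal.pow_le_pow_right (by omega : K₀ ≤ K)) (yu1Ideal c ^ μ) h)
  have hw : ∀ i, 0 < wK1 r K i := wK1_pos (by omega)
  have hfW : f ∉ weightedOrderIdeal c (wK1 r K) (K * μ) := fun h => hfK (weightedOrderIdeal_wK1_le c hgen K μ h)
  rw [mem_weightedOrderIdeal_iff_forall_isInitialTerm c hgen hdim hw] at hfW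
  push Not at hfW
  obtain ⟨e, he, hlt⟩ := hfW
  rw [weight_wK1] at hlt
  have h01 : ydeg e + e (u1 r) + 1 ≤ μ := by
    by_contra h'
    push Not at h'
    have : K * μ ≤ K * (ydeg e + e (u1 r)) := Nat.mul_le_mul_left _ (by omega)
    omega
  have he0 : ydeg e < μ := by omega
  have hpts : e ∈ pts c J μ := ⟨mem_occ_of_isInitialTerm c hfJ hw he, he0⟩
  refine ⟨⟨e, hpts⟩, lt_of_le_of_lt (alphaS_le hpts) ?_⟩
  rw [spt₁, ← sub_mul_sfac he0]
  exact Nat.mul_lt_mul_of_pos_right (by omega) (sfac_pos he0)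

include hgen hdim in
/-- **`J ⊄ (y, u₂)^μ ⇒ ε < 1`** (scaled: `εs < L`) — CJS Lemma 11.5's `ε`-half. [cite: CossartJannsenSaito2020, Lemma 11.5] [cite: CossartPiltant2008, (16)] -/
theorem epsS_lt_of_not_le_yu2_pow (hJ : ¬ J ≤ yu2Ideal c ^ μ) : (pts c J μ).Nonempty ∧ epsS c J μ < μ.factorial := by
  classical
  obtain ⟨f, hfJ, hf⟩ := Set.not_subset.mp hJ
  obtain ⟨K₀, hK₀⟩ := exists_not_mem_sup_pow hf
  set K := K₀ + 1 with hK
  have hfK : f ∉ yu2Ideal c ^ μ ⊔ maximalIdeal R ^ K := fun h =>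
    hK₀ (sup_le_sup_left (Ideal.pow_le_pow_right (by omega : K₀ ≤ K)) (yu2Ideal c ^ μ) h)
  have hw : ∀ i, 0 < wK2 r K i := wK2_pos (by omega)
  have hfW : f ∉ weightedOrderIdeal c (wK2 r K) (K * μ) := fun h => hfK (weightedOrderIdeal_wK2_le c hgen K μ h)
  rw [mem_weightedOrderIdeal_iff_forall_isInitialTerm c hgen hdim hw] at hfW
  push Not at hfW
  obtain ⟨e, he, hlt⟩ := hfW
  rw [weight_wK2] at hlt
  have h02 : ydeg e + e (u2 r) + 1 ≤ μ := by
    by_contra h'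
    push Not at h'
    have : K * μ ≤ K * (ydeg e + e (u2 r)) := Nat.mul_le_mul_left _ (by omega)
    omega
  have he0 : ydeg e < μ := by omega
  have hpts : e ∈ pts c J μ := ⟨mem_occ_of_isInitialTerm c hfJ hw he, he0⟩
  refine ⟨⟨e, hpts⟩, lt_of_le_of_lt (epsS_le hpts) ?_⟩
  rw [spt₂, ← sub_mul_sfac he0]
  exact Nat.mul_lt_mul_of_pos_right (by omega) (sfac_pos he0)

include hgen hdim in
/-- **`J ⊄ (y)^μ ⇒` Newton points exist.** [cite: CossartJannsenSaito2020, Def. 8.4] -/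
theorem pts_nonempty_of_not_le_y_pow (hJ : ¬ J ≤ yIdeal c ^ μ) : (pts c J μ).Nonempty := by
  classical
  obtain ⟨f, hfJ, hf⟩ := Set.not_subset.mp hJ
  obtain ⟨K₀, hK₀⟩ := exists_not_mem_sup_pow hf
  set K := K₀ + 1 with hK
  have hfK : f ∉ yIdeal c ^ μ ⊔ maximalIdeal R ^ K := fun h =>
    hK₀ (sup_le_sup_left (Ideal.pow_le_pow_right (by omega : K₀ ≤ K)) (yIdeal c ^ μ) h)
  have hw : ∀ i, 0 < wKy r K i := wKy_pos (by omega)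
  have hfW : f ∉ weightedOrderIdeal c (wKy r K) (K * μ) := fun h => hfK (weightedOrderIdeal_wKy_le c hgen K μ h)
  rw [mem_weightedOrderIdeal_iff_forall_isInitialTerm c hgen hdim hw] at hfW
  push Not at hfW
  obtain ⟨e, he, hlt⟩ := hfW
  rw [weight_wKy] at hlt
  have he0 : ydeg e < μ := by
    by_contra h'
    push Not at h'
    have : K * μ ≤ K * ydeg e := Nat.mul_le_mul_left _ h'
    omega
  exact ⟨e, mem_occ_of_isInitialTerm c hfJ hw he, he0⟩

end IsolationRegular

/-! ## Unit representatives inside `(y, u₁)^μ` -/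

section PPow

variable {R : Type u} [CommRing R] [IsRegularLocalRing R] {r : ℕ} (c : Fin (r + 2) → R)
  (hgen : Ideal.span (Set.range c) = maximalIdeal R) (hdim : ringKrullDim R = r + 2)

omit [IsRegularLocalRing R] in
/-- `(y, u₁)^μ ⊆ F^{(K,…,K,K,1)}_{Kμ}` for every `K`. [cite: CossartJannsenSaito2020, Lemma 12.4 (1)] -/
theorem yu1Ideal_pow_le_weightedOrderIdeal (μ K : ℕ) : yu1Ideal c ^ μ ≤ weightedOrderIdeal c (wK1 r K) (K * μ) := by
  have h1 : yu1Ideal c ≤ weightedOrderIdeal c (wK1 r K) K := by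
    rw [yu1Ideal, Ideal.span_le]
    have key : ∀ i : Fin (r + 2), i ≠ u2 r → c i ∈ weightedOrderIdeal c (wK1 r K) K := by
      intro i hi
      have hw : wK1 r K i = K := by simp [wK1, hi]
      have := apply_mem_weightedOrderIdeal c (wK1 r K) i
      rwa [hw] at this
    rintro x hx
    rcases hx with rfl | ⟨i, rfl⟩
    · exact key (u1 r) (fun h => by have := congrArg Fin.val h; simp [u1, u2, Fin.natAdd] at this)
    · exact key (Fin.castAdd 2 i) (castAdd_ne_u2 i)
  induction μ with
  | zero => rw [pow_zero, mul_zero, weightedOrderIdeal_zero, Ideal.one_eq_top]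
  | succ n ih =>
    rw [pow_succ, Nat.mul_succ]
    exact (Ideal.mul_mono ih h1).trans (weightedOrderIdeal_mul_le c _ _ _)

include hgen hdim in
/-- **Unit representatives in `(y, u₁)^μ`**: if all the memberships `f ∈ F^{(K,K,1)}_{Kμ}` hold
(e.g. `f ∈ (y, u₁)^μ`), then modulo `F^{(w)}_K`, for any positive `w` and any `K`, `f` is a
polynomial `G(c)` with unit coefficients supported in `{e₀ + e₁ ≥ μ}` (the monomials of a unit
representative with `e₀ + e₁ < μ` have `e₂ ≥ K` and are moved into the remainder).
[cite: CossartJannsenSaito2020, Lemma 12.4 (1), (12.5)] -/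
theorem exists_unitRep_pPow {w : Fin (r + 2) → ℕ} (hw : ∀ i, 0 < w i) {f : R} {μ : ℕ}
    (hf : ∀ K, f ∈ weightedOrderIdeal c (wK1 r K) (K * μ)) (K : ℕ) :
    ∃ G : MvPolynomial (Fin (r + 2)) R, HasUnitCoeffs G ∧ (∀ m ∈ G.support, μ ≤ ydeg m + m (u1 r)) ∧
      f - eval c G ∈ weightedOrderIdeal c w K := by
  classical
  set M := K * μ + μ + K with hM
  obtain ⟨F, hFu, -, hFrem⟩ := exists_unitRep c hgen f M
  have hKw : ∀ i, 0 < wK1 r (K + 1) i := wK1_pos (by omega)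
  have hremK : f - eval c F ∈ weightedOrderIdeal c (wK1 r (K + 1)) M :=
    pow_maximalIdeal_le_weightedOrderIdeal c _ hKw hgen M hFrem
  have hlev : (K + 1) * μ ≤ M := by
    rw [hM, Nat.add_mul, one_mul]; omega
  have hall := (mem_weightedOrderIdeal_iff_of_unitRep c hgen hdim hKw hFu hremK hlev).mp (hf (K + 1))
  -- keep the monomials with `e₀ + e₁ ≥ μ`
  set S := F.support.filter (fun m => μ ≤ ydeg m + m (u1 r)) with hS
  set G : MvPolynomial (Fin (r + 2)) R := ∑ m ∈ S, monomial m (F.coeff m) with hG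
  have hGcoeff : ∀ m, G.coeff m = if m ∈ S then F.coeff m else 0 := by
    intro m
    rw [hG, coeff_sum]
    simp_rw [coeff_monomial]
    rw [Finset.sum_ite_eq']
  have hGsupp : ∀ m ∈ G.support, m ∈ S := by
    intro m hm
    rw [mem_support_iff, hGcoeff] at hm
    by_contra h; rw [if_neg h] at hm; exact hm rfl
  refine ⟨G, ?_, ?_, ?_⟩
  · intro m hm
    have hmS := hGsupp m hm
    rw [hGcoeff, if_pos hmS]
    exact hFu m (Finset.mem_filter.mp hmS).1
  · intro m hm
    exact (Finset.mem_filter.mp (hGsupp m hm)).2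
  · -- `f - G(c) = (f - F(c)) + (F - G)(c)`, and `F - G` has monomials with `e₂ ≥ K + 1`
    have hdiff : eval c (F - G) ∈ weightedOrderIdeal c w K := by
      refine eval_mem_weightedOrderIdeal_of_forall_le c w fun m hm => ?_
      rw [mem_support_iff, coeff_sub, hGcoeff] at hm
      have hmF : m ∈ F.support := by
        by_contra h
        rw [notMem_support_iff.mp h] at hm
        split_ifs at hm with h' <;> simp at hm
      have hmS : m ∉ S := by
        intro h; rw [if_pos h, sub_self] at hm; exact hm rfl
      have hlt : ydeg m + m (u1 r) < μ := by
        by_contra h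
        exact hmS (Finset.mem_filter.mpr ⟨hmF, not_lt.mp h⟩)
      have hwm := hall m hmF
      rw [weight_wK1] at hwm
      have hm2 : K + 1 ≤ m (u2 r) := by
        have : (K + 1) * (ydeg m + m (u1 r)) + (K + 1) ≤ (K + 1) * μ := by
          rw [← Nat.mul_succ]; exact Nat.mul_le_mul_left _ hlt
        omega
      have hwm2 : m (u2 r) • w (u2 r) ≤ Finsupp.weight w m := by
        rw [Finsupp.weight_apply, Finsupp.sum_fintype _ _ (by simp)]
        exact Finset.single_le_sum (f := fun i => m i • w i) (fun i _ => Nat.zero_le _) (Finset.mem_univ (u2 r))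
      rw [smul_eq_mul] at hwm2
      have hw2 : 1 ≤ w (u2 r) := hw (u2 r)
      have : (K + 1) * 1 ≤ m (u2 r) * w (u2 r) := Nat.mul_le_mul hm2 hw2
      omega
    have hrem : f - eval c F ∈ weightedOrderIdeal c w K :=
      weightedOrderIdeal_antitone c w (by omega) (pow_maximalIdeal_le_weightedOrderIdeal c _ hw hgen M hFrem)
    have : f - eval c G = (f - eval c F) + eval c (F - G) := by rw [map_sub]; ring
    rw [this]
    exact Ideal.add_mem _ hrem hdiff

end PPow

end WeightedOrder

end Literature.AlgebraicGeometry.Resolution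

end
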